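import Mathlib
import HarnessLib
import Literature.Geometry.DiscreteGeometry.KissingPatterns

/-!
# Non-contact pairs of the HCP kissing pattern: the integer tables (crux `SoftLayerPropagation`, line `Sketch`)

Route `PricedLinkCensus`, crux `SoftLayerPropagation` (stmt-AtomisticToContinuum-14233), line
`Sketch`, helper file for the stub `develop_HX_hcp` (local no-merge at an HCP-type site): the purely
combinatorial facts about the anticuboctahedron (`hcpInt`, the integer model scaled by `3`, contact
`|v − w|² = 18`) that the case analysis of `develop_HX_hcp` consumes.  In the unit picture the twelve
points are the basal hexagon `b_θ` (`θ ∈ 60ℤ`), the upper triangle `u_30, u_150, u_270` and its mirror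
image `l_30, l_150, l_270` below the basal plane.

* `hcpInt_noncontact_cases`: two distinct non-contacts have `|v − w|² ∈ {36, 48, 54, 66, 72}`
  (unit squared distances `2, 8/3, 3, 11/3, 4`);
* `36`, SQUARE DIAGONAL (`hcpInt_square`): two common contacts `a, b`, themselves a square diagonal;
* `48`, VERTICAL PAIR `(u_θ, l_θ)` (`hcpInt_vertical`): two common basal contacts `b, b'` in contact;
* `54` (`hcpInt_hexagon`): for the pair in one of its two orders, the common contact `w`, the third
  vertex `p` of the contact triangle `u w p` and the fourth corner `s` of the square `p w k s` — the edge
  `w k` of the anticuboctahedron then lies in two squares and the edge `u w` in two triangles, which is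
  why the order matters;
* `66`, SKEW PAIR `(u_30, l_150)` (`hcpInt_skew`): the basal points `p = b_60`, `q = b_120`,
  `q' = b_180`, the upper point `u₂ = u_150` and the lower point `l₁ = l_30`, with the (non-)contacts of
  the upper square `p q u₂ u`, the lower square `p q k l₁` and the bipyramid `(x, q, q'; u₂, k)`;
* `72`, ANTIPODAL (`hcpInt_antipodal`): `w = −v`.

Everything is a `decide` over the twelve-element table.  All `[folklore]` (elementary geometry of the
anticuboctahedron, cf. HalesDSP2012 §1.3).
-/

namespace Summit.AtomisticToContinuum.Crystallization.Theorems

open Literature.Geometry.DiscreteGeometry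

set_option maxRecDepth 8000
set_option synthInstance.maxSize 8192
set_option synthInstance.maxHeartbeats 800000

/-- **HCP: the five classes of non-contact pairs.**  Two distinct non-contacts of the anticuboctahedron
have integer squared distance `36`, `48`, `54`, `66` or `72`. [folklore] -/
theorem hcpInt_noncontact_cases : ∀ v ∈ Literature.Geometry.DiscreteGeometry.hcpInt, ∀ w ∈ Literature.Geometry.DiscreteGeometry.hcpInt, v ≠ w → Literature.Geometry.DiscreteGeometry.sqNormInt (v - w) ≠ (18 : ℕ) → Literature.Geometry.DiscreteGeometry.sqNormInt (v - w) = 36 ∨ Literature.Geometry.DiscreteGeometry.sqNormInt (v - w) = 48 ∨ Literature.Geometry.DiscreteGeometry.sqNormInt (v - w) = 54 ∨ Literature.Geometry.DiscreteGeometry.sqNormInt (v - w) = 66 ∨ Literature.Geometry.DiscreteGeometry.sqNormInt (v - w) = 72 := by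
  decide

/-- HCP: squared distance `72` means antipodal (a basal pair). [folklore] -/
theorem hcpInt_antipodal : ∀ v ∈ hcpInt, ∀ w ∈ hcpInt, sqNormInt (v - w) = 72 → w = -v := by
  decide

/-- HCP: a square diagonal `v, w` (`|v − w|² = 36`) has two common contacts `a, b`, themselves a square
diagonal. [folklore] -/
theorem hcpInt_square : ∀ v ∈ hcpInt, ∀ w ∈ hcpInt, sqNormInt (v - w) = 36 →
    ∃ a ∈ hcpInt, sqNormInt (v - a) = (18 : ℕ) ∧ sqNormInt (a - w) = (18 : ℕ) ∧
      ∃ b ∈ hcpInt, sqNormInt (w - b) = (18 : ℕ) ∧ sqNormInt (b - v) = (18 : ℕ) ∧ a ≠ b ∧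
        sqNormInt (a - b) ≠ (18 : ℕ) := by
  decide

/-- HCP: a vertical pair `v = u_θ`, `w = l_θ` (`|v − w|² = 48`) has two common basal contacts `b, b'`,
in contact with each other (the common face `x b b'` of the two contact tetrahedra). [folklore] -/
theorem hcpInt_vertical : ∀ v ∈ hcpInt, ∀ w ∈ hcpInt, sqNormInt (v - w) = 48 →
    ∃ b ∈ hcpInt, sqNormInt (b - v) = (18 : ℕ) ∧ sqNormInt (b - w) = (18 : ℕ) ∧
      ∃ b' ∈ hcpInt, sqNormInt (b' - v) = (18 : ℕ) ∧ sqNormInt (b' - w) = (18 : ℕ) ∧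
        sqNormInt (b - b') = (18 : ℕ) := by
  decide

/-- HCP: around a pair `u, k` with `|u − k|² = 54`, in one of its two orders: the common contact `w`,
the third vertex `p` of the contact triangle `u w p` (not in contact with `k`), and the fourth corner
`s` of the square `p w k s` (not in contact with `w`). [folklore] -/
theorem hcpInt_hexagon : ∀ u ∈ hcpInt, ∀ k ∈ hcpInt, sqNormInt (u - k) = 54 →
    (∃ w ∈ hcpInt, sqNormInt (w - u) = (18 : ℕ) ∧ sqNormInt (w - k) = (18 : ℕ) ∧
      ∃ p ∈ hcpInt, sqNormInt (p - u) = (18 : ℕ) ∧ sqNormInt (p - w) = (18 : ℕ) ∧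
        sqNormInt (p - k) ≠ (18 : ℕ) ∧ p ≠ k ∧
      ∃ s ∈ hcpInt, sqNormInt (s - p) = (18 : ℕ) ∧ sqNormInt (k - s) = (18 : ℕ) ∧
        sqNormInt (w - s) ≠ (18 : ℕ) ∧ w ≠ s) ∨
    (∃ w ∈ hcpInt, sqNormInt (w - k) = (18 : ℕ) ∧ sqNormInt (w - u) = (18 : ℕ) ∧
      ∃ p ∈ hcpInt, sqNormInt (p - k) = (18 : ℕ) ∧ sqNormInt (p - w) = (18 : ℕ) ∧
        sqNormInt (p - u) ≠ (18 : ℕ) ∧ p ≠ u ∧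
      ∃ s ∈ hcpInt, sqNormInt (s - p) = (18 : ℕ) ∧ sqNormInt (u - s) = (18 : ℕ) ∧
        sqNormInt (w - s) ≠ (18 : ℕ) ∧ w ≠ s) := by
  decide

/-- HCP: around a skew pair `u = u_30`, `k = l_150` (`|u − k|² = 66`): the basal points `p = b_60`,
`q = b_120`, the upper point `u₂ = u_150`, the lower point `l₁ = l_30` and the basal point `q' = b_180`,
with the contacts and non-contacts of the upper square `p q u₂ u` (diagonals `q u`, `p u₂`), the lower
square `p q k l₁` (diagonals `p k`, `q l₁`) and the bipyramid on the face `x q q'` with apices `u₂, k`.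
[folklore] -/
theorem hcpInt_skew : ∀ u ∈ hcpInt, ∀ k ∈ hcpInt, sqNormInt (u - k) = 66 →
    ∃ p ∈ hcpInt, sqNormInt (p - u) = (18 : ℕ) ∧
    ∃ q ∈ hcpInt, sqNormInt (p - q) = (18 : ℕ) ∧ sqNormInt (q - k) = (18 : ℕ) ∧
      sqNormInt (q - u) ≠ (18 : ℕ) ∧ q ≠ u ∧ sqNormInt (p - k) ≠ (18 : ℕ) ∧ p ≠ k ∧
    ∃ u₂ ∈ hcpInt, sqNormInt (u₂ - q) = (18 : ℕ) ∧ sqNormInt (u₂ - u) = (18 : ℕ) ∧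
      sqNormInt (p - u₂) ≠ (18 : ℕ) ∧ p ≠ u₂ ∧ sqNormInt (u₂ - k) ≠ (18 : ℕ) ∧ u₂ ≠ k ∧
    ∃ l₁ ∈ hcpInt, sqNormInt (l₁ - p) = (18 : ℕ) ∧ sqNormInt (l₁ - k) = (18 : ℕ) ∧
      sqNormInt (q - l₁) ≠ (18 : ℕ) ∧ q ≠ l₁ ∧
    ∃ q' ∈ hcpInt, sqNormInt (q' - q) = (18 : ℕ) ∧ sqNormInt (q' - u₂) = (18 : ℕ) ∧
      sqNormInt (q' - k) = (18 : ℕ) := by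
  decide

end Summit.AtomisticToContinuum.Crystallization.Theorems
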